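import Mathlib
import Literature.Analysis.FluidPDE.VectorCalculus
import Literature.Analysis.FluidPDE.SteadyLiouvilleTsaiKit
import Summits.NavierStokesRegularity.NavierStokesRegularity.Theorems.ThreadingFluxHorizonTowerProfileFormulas
import Summits.NavierStokesRegularity.NavierStokesRegularity.Theorems.ThreadingFluxErtelTowerInviscidStrainRigidity
import HarnessLib

/-!
# Crux `PoloidalLiouville` (stmt-NavierStokesRegularity-1222, W1), crux idea «radial-jerk-tower» (ns-idea-15 g7):
# THE VISCOUS STRAIN-SHADOW SURVIVOR `B⋆ = exp(xᵀSx/2ν)·(Sx × x)` — «false-without-bounded» in the linear strain shadow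

Support file (`--supports stmt-NavierStokesRegularity-1222`, helper; critic V21 sizes: `StrainShadowSurvivor` S/M, «pure
calculus with exp∘quadForm»).  Experiment cell `ns-wall-extremal`, width hand ns-wall-eng-5 g6, director KEY-NS #186.  0 kit.

For `ν > 0` and a trace-free diagonal strain `S = diag(a,b,c)`, with `σ = exp(xᵀSx/2ν)` and `τ = Sx × x` (`topField`):
* `fderiv_quadForm_apply` (`D(xᵀSx)[v] = 2⟪Sx,v⟫`), `fderiv_sigma_apply` / `gradient_sigma` (`∇σ = (σ/ν)Sx`),
  `divergence_strain` (`= tr S`), `laplacian_sigma` (`Δσ = σ‖Sx‖²/ν²` when `tr S = 0`);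
* `laplacian_topField_apply` (`Δτᵢ = 0`), `divergence_topField` (`div τ = 0`), `fderiv_survivor_apply`,
  `laplacian_survivor_apply` (componentwise Leibniz rules for `B⋆ = στ`, via `Tsai2021.laplacian_mul_eq` and
  `ContDiffAt.laplacian_CLM_comp_left`);
* ★ `ErtelTower.strainShadowSurvivor : StrainShadowSurvivor` — **the sketch Prop (`ErtelTowerSketch.lean` l.529, twin in
  `ThreadingFluxErtelTowerDefs`) is a theorem**: `DB⋆[Sx] − SB⋆ = νΔB⋆` on `ℝ³` (both sides `= σ(‖Sx‖²/ν · τ − 2Sτ)`,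
  the algebraic content of `survivor_balance` / `dTau_strain`), `div B⋆ = 0` (`⟪Sx, τ⟫ = 0`), `⟪B⋆, x⟫ = 0`, and `B⋆ ≠ 0`
  somewhere as soon as two principal strains differ.

HONEST FRAME (critic V21-P1, mandatory words): `B⋆` is the «false-without-bounded» witness for the LINEAR STRAIN SHADOW — the
passive vector equation in the PRESCRIBED, UNBOUNDED drift `Sx`; `B⋆` is not the curl of a bounded Navier–Stokes velocity, and
this is NOT a Disproof/`Negative/` entry for ⟨1222⟩ (such an entry must negate a hypothesis-dropped variant of `PoloidalLiouville`
itself).  `PoloidalLiouville` (1222), `stub_scalarLiouville`, ⟨27585⟩ and NS regularity are OPEN.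
-/

-- the summit and its single problem share the name (D-0017 nested layout)
set_option linter.dupNamespace false

noncomputable section

namespace Summit.NavierStokesRegularity.NavierStokesRegularity.Theorems.PoloidalLiouville.ErtelTower

open Set Function Filter Topology Metric
open scoped Topology RealInnerProductSpace InnerProductSpace Laplacian
open Literature.Analysis.FluidPDE
open Summit.NavierStokesRegularity.NavierStokesRegularity.Theorems.PoloidalLiouville.HorizonTower
  (E3 divergence_gradient_eq_laplacian_of_contDiffAt)

/-! ### The quadratic form, the strain and the Gaussian weight -/

section Survivor

variable (ν a b c : ℝ)

/-- `xᵀSx` is smooth. -/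
theorem contDiff_quadForm {n : WithTop ℕ∞} : ContDiff ℝ n (quadForm a b c) := by
  unfold quadForm
  exact ((contDiff_const.mul ((EuclideanSpace.proj (𝕜 := ℝ) (ι := Fin 3) 0).contDiff.pow 2)).add (contDiff_const.mul ((EuclideanSpace.proj (𝕜 := ℝ) (ι := Fin 3) 1).contDiff.pow 2))).add
    (contDiff_const.mul ((EuclideanSpace.proj (𝕜 := ℝ) (ι := Fin 3) 2).contDiff.pow 2))

/-- `⟪Sx, v⟫` in coordinates. -/
theorem inner_strain (x v : E3) : inner ℝ (strain a b c x) v = a * x 0 * v 0 + b * x 1 * v 1 + c * x 2 * v 2 := by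
  simp [strain, EuclideanSpace.inner_eq_star_dotProduct, dotProduct, Fin.sum_univ_three]
  ring

/-- `D(xᵀSx)[v] = 2⟪Sx, v⟫`. -/
theorem fderiv_quadForm_apply (x v : E3) : fderiv ℝ (quadForm a b c) x v = 2 * inner ℝ (strain a b c x) v := by
  have h : HasFDerivAt (fun y : E3 => a * y 0 ^ 2 + b * y 1 ^ 2 + c * y 2 ^ 2) _ x :=
    ((((EuclideanSpace.proj (𝕜 := ℝ) (ι := Fin 3) 0).hasFDerivAt (x := x)).pow 2).const_mul a |>.add ((((EuclideanSpace.proj (𝕜 := ℝ) (ι := Fin 3) 1).hasFDerivAt (x := x)).pow 2).const_mul b)).add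
      ((((EuclideanSpace.proj (𝕜 := ℝ) (ι := Fin 3) 2).hasFDerivAt (x := x)).pow 2).const_mul c)
  have hfun : quadForm a b c = fun y : E3 => a * y 0 ^ 2 + b * y 1 ^ 2 + c * y 2 ^ 2 := rfl
  rw [hfun, h.fderiv, inner_strain]
  simp
  ring

/-- The Gaussian weight `σ = exp(xᵀSx / 2ν)` is smooth. -/
theorem contDiff_sigma {n : WithTop ℕ∞} : ContDiff ℝ n (fun y : E3 => Real.exp (quadForm a b c y / (2 * ν))) :=
  ((contDiff_quadForm a b c).div_const _).exp

/-- `Dσ[v] = σ ⟪Sx, v⟫ / ν`. -/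
theorem fderiv_sigma_apply (hν : ν ≠ 0) (x v : E3) :
    fderiv ℝ (fun y : E3 => Real.exp (quadForm a b c y / (2 * ν))) x v
      = Real.exp (quadForm a b c x / (2 * ν)) * (inner ℝ (strain a b c x) v / ν) := by
  have hq : HasFDerivAt (quadForm a b c) (fderiv ℝ (quadForm a b c) x) x :=
    ((contDiff_quadForm a b c (n := 1)).differentiable (by simp) x).hasFDerivAt
  have hφ : HasFDerivAt (fun y : E3 => quadForm a b c y / (2 * ν)) ((2 * ν)⁻¹ • fderiv ℝ (quadForm a b c) x) x := by
    have h := hq.const_mul (2 * ν)⁻¹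
    have hfun : (fun y : E3 => quadForm a b c y / (2 * ν)) = fun y => (2 * ν)⁻¹ * quadForm a b c y := by
      funext y; rw [div_eq_inv_mul]
    rw [hfun]; exact h
  rw [hφ.exp.fderiv]
  simp only [_root_.FunLike.coe_smul, Pi.smul_apply, smul_eq_mul, fderiv_quadForm_apply]
  field_simp

/-- `∇σ = (σ/ν) Sx`. -/
theorem gradient_sigma (hν : ν ≠ 0) (x : E3) :
    gradient (fun y : E3 => Real.exp (quadForm a b c y / (2 * ν))) x
      = (Real.exp (quadForm a b c x / (2 * ν)) / ν) • strain a b c x := by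
  apply ext_inner_right ℝ
  intro v
  rw [Literature.Analysis.FluidPDE.inner_gradient_left, fderiv_sigma_apply ν a b c hν, real_inner_smul_left]
  ring

/-- `div (Sx) = tr S = a + b + c`. -/
theorem divergence_strain (x : E3) : VectorCalculus.divergence (strain a b c) x = a + b + c := by
  obtain ⟨L, hL, hLd⟩ := hasFDerivAt_strain a b c x
  rw [Literature.Analysis.FluidPDE.divergence_eq_sum_inner_fderiv (EuclideanSpace.basisFun (Fin 3) ℝ), hLd.fderiv]
  simp only [EuclideanSpace.basisFun_apply, hL, Fin.sum_univ_three]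
  simp [strain, EuclideanSpace.inner_eq_star_dotProduct, dotProduct, Fin.sum_univ_three]

/-- `‖Sx‖² = a²x₀² + b²x₁² + c²x₂²`. -/
theorem norm_sq_strain (x : E3) : ‖strain a b c x‖ ^ 2 = a ^ 2 * x 0 ^ 2 + b ^ 2 * x 1 ^ 2 + c ^ 2 * x 2 ^ 2 := by
  rw [← real_inner_self_eq_norm_sq, inner_strain]
  simp [strain]
  ring

/-- **`Δσ = σ‖Sx‖²/ν²`** for trace-free `S` (computed as `div ∇σ = div((σ/ν)Sx) = (σ/ν) tr S + ⟪∇(σ/ν), Sx⟫`). -/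
theorem laplacian_sigma (hν : ν ≠ 0) (htr : a + b + c = 0) (x : E3) :
    (Δ fun y : E3 => Real.exp (quadForm a b c y / (2 * ν))) x
      = Real.exp (quadForm a b c x / (2 * ν)) * ‖strain a b c x‖ ^ 2 / ν ^ 2 := by
  have h2 : ContDiffAt ℝ 2 (fun y : E3 => Real.exp (quadForm a b c y / (2 * ν))) x :=
    (contDiff_sigma ν a b c).contDiffAt
  rw [← divergence_gradient_eq_laplacian_of_contDiffAt h2]
  have hgrad : gradient (fun y : E3 => Real.exp (quadForm a b c y / (2 * ν)))
      = fun y => (Real.exp (quadForm a b c y / (2 * ν)) / ν) • strain a b c y :=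
    funext fun y => gradient_sigma ν a b c hν y
  rw [hgrad]
  have hσd : DifferentiableAt ℝ (fun y : E3 => Real.exp (quadForm a b c y / (2 * ν))) x :=
    (contDiff_sigma ν a b c (n := 1)).differentiable (by simp) x
  have hθ : DifferentiableAt ℝ (fun y : E3 => Real.exp (quadForm a b c y / (2 * ν)) / ν) x :=
    ((contDiff_sigma ν a b c (n := 1)).div_const ν).differentiable (by simp) x
  obtain ⟨L, hL, hLd⟩ := hasFDerivAt_strain a b c x
  rw [HorizonTower.divergence_smul_apply hθ hLd.differentiableAt, divergence_strain, htr, mul_zero, zero_add]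
  have hfun : (fun y : E3 => Real.exp (quadForm a b c y / (2 * ν)) / ν)
      = fun y : E3 => Real.exp (quadForm a b c y / (2 * ν)) * ν⁻¹ := funext fun _ => div_eq_mul_inv _ _
  rw [hfun, fderiv_mul_const hσd]
  simp only [_root_.FunLike.coe_smul, Pi.smul_apply, smul_eq_mul, fderiv_sigma_apply ν a b c hν,
    real_inner_self_eq_norm_sq]
  field_simp

/-! ### The Euler-top field `τ = Sx × x`, componentwise -/

/-- The components of `τ`. -/
theorem topField_apply (y : E3) :
    topField a b c y 0 = (b - c) * y 1 * y 2 ∧ topField a b c y 1 = (c - a) * y 2 * y 0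
      ∧ topField a b c y 2 = (a - b) * y 0 * y 1 := by
  simp [topField]

/-- `τ` is smooth, componentwise. -/
theorem contDiff_topField_apply (i : Fin 3) {n : WithTop ℕ∞} : ContDiff ℝ n (fun y : E3 => topField a b c y i) := by
  fin_cases i
  · exact (contDiff_const.mul (EuclideanSpace.proj (𝕜 := ℝ) (ι := Fin 3) 1).contDiff).mul (EuclideanSpace.proj (𝕜 := ℝ) (ι := Fin 3) 2).contDiff
  · exact (contDiff_const.mul (EuclideanSpace.proj (𝕜 := ℝ) (ι := Fin 3) 2).contDiff).mul (EuclideanSpace.proj (𝕜 := ℝ) (ι := Fin 3) 0).contDiff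
  · exact (contDiff_const.mul (EuclideanSpace.proj (𝕜 := ℝ) (ι := Fin 3) 0).contDiff).mul (EuclideanSpace.proj (𝕜 := ℝ) (ι := Fin 3) 1).contDiff

/-- `τ` is smooth. -/
theorem contDiff_topField {n : WithTop ℕ∞} : ContDiff ℝ n (topField a b c) :=
  contDiff_euclidean.mpr fun i => contDiff_topField_apply a b c i

/-- Derivative of a monomial `k·yᵢ·yⱼ`: `k (vᵢ xⱼ + xᵢ vⱼ)`. -/
theorem fderiv_monomial_apply (k : ℝ) (i j : Fin 3) (x v : E3) :
    fderiv ℝ (fun y : E3 => k * y i * y j) x v = k * (v i * x j + x i * v j) := by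
  have h : HasFDerivAt (fun y : E3 => k * y i * y j) _ x :=
    (((EuclideanSpace.proj (𝕜 := ℝ) (ι := Fin 3) i).hasFDerivAt (x := x)).const_mul k).mul ((EuclideanSpace.proj (𝕜 := ℝ) (ι := Fin 3) j).hasFDerivAt (x := x))
  rw [h.fderiv]
  simp
  ring

/-- The components of `τ` are harmonic. -/
theorem laplacian_topField_apply (x : E3) (i : Fin 3) : (Δ fun y : E3 => topField a b c y i) x = 0 := by
  fin_cases i
  · exact laplacian_const_mul_coord_mul_coord (b - c) (by decide) x
  · exact laplacian_const_mul_coord_mul_coord (c - a) (by decide) x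
  · exact laplacian_const_mul_coord_mul_coord (a - b) (by decide) x

/-- `div τ = 0` (no component of `τ` depends on its own coordinate). -/
theorem divergence_topField (x : E3) : VectorCalculus.divergence (topField a b c) x = 0 := by
  have hd : DifferentiableAt ℝ (topField a b c) x := (contDiff_topField a b c (n := 1)).differentiable (by simp) x
  rw [Literature.Analysis.FluidPDE.divergence_eq_sum_inner_fderiv (EuclideanSpace.basisFun (Fin 3) ℝ)]
  have hcomp : ∀ k : Fin 3, inner ℝ ((EuclideanSpace.basisFun (Fin 3) ℝ) k) (fderiv ℝ (topField a b c) x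
      ((EuclideanSpace.basisFun (Fin 3) ℝ) k)) = fderiv ℝ (fun y => topField a b c y k) x (EuclideanSpace.single k 1) := by
    intro k
    rw [EuclideanSpace.basisFun_apply, EuclideanSpace.inner_single_left]
    have h := ((EuclideanSpace.proj (𝕜 := ℝ) (ι := Fin 3) k).hasFDerivAt.comp x hd.hasFDerivAt).fderiv
    have hfun : (fun y => topField a b c y k) = (EuclideanSpace.proj (𝕜 := ℝ) (ι := Fin 3) k) ∘ topField a b c := rfl
    rw [hfun, h]
    simp
  simp only [hcomp, Fin.sum_univ_three]
  rw [show (fun y => topField a b c y 0) = fun y : E3 => (b - c) * y 1 * y 2 from funext fun y => (topField_apply a b c y).1,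
    show (fun y => topField a b c y 1) = fun y : E3 => (c - a) * y 2 * y 0 from funext fun y => (topField_apply a b c y).2.1,
    show (fun y => topField a b c y 2) = fun y : E3 => (a - b) * y 0 * y 1 from funext fun y => (topField_apply a b c y).2.2,
    fderiv_monomial_apply, fderiv_monomial_apply, fderiv_monomial_apply]
  simp

/-! ### The survivor `B⋆ = σ τ` -/

/-- `B⋆` is smooth. -/
theorem contDiff_survivor {n : WithTop ℕ∞} :
    ContDiff ℝ n (fun y : E3 => Real.exp (quadForm a b c y / (2 * ν)) • topField a b c y) :=
  (contDiff_sigma ν a b c).smul (contDiff_topField a b c)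

/-- Components of `B⋆`: `(σ τ)ᵢ = σ τᵢ`. -/
theorem survivor_apply (y : E3) (i : Fin 3) :
    (Real.exp (quadForm a b c y / (2 * ν)) • topField a b c y) i
      = Real.exp (quadForm a b c y / (2 * ν)) * topField a b c y i := by
  simp

/-- Componentwise derivative of `B⋆` along `v`:  `(DB⋆[v])ᵢ = Dσ[v] τᵢ + σ Dτᵢ[v]`. -/
theorem fderiv_survivor_apply (hν : ν ≠ 0) (x v : E3) (i : Fin 3) :
    (fderiv ℝ (fun y : E3 => Real.exp (quadForm a b c y / (2 * ν)) • topField a b c y) x v) i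
      = Real.exp (quadForm a b c x / (2 * ν)) * (inner ℝ (strain a b c x) v / ν) * topField a b c x i
        + Real.exp (quadForm a b c x / (2 * ν)) * fderiv ℝ (fun y : E3 => topField a b c y i) x v := by
  have hd : DifferentiableAt ℝ (fun y : E3 => Real.exp (quadForm a b c y / (2 * ν)) • topField a b c y) x :=
    (contDiff_survivor ν a b c (n := 1)).differentiable (by simp) x
  have hσd : DifferentiableAt ℝ (fun y : E3 => Real.exp (quadForm a b c y / (2 * ν))) x :=
    (contDiff_sigma ν a b c (n := 1)).differentiable (by simp) x
  have hτd : DifferentiableAt ℝ (fun y : E3 => topField a b c y i) x :=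
    (contDiff_topField_apply a b c i (n := 1)).differentiable (by simp) x
  have h := ((EuclideanSpace.proj (𝕜 := ℝ) (ι := Fin 3) i).hasFDerivAt.comp x hd.hasFDerivAt).fderiv
  have hfun : (EuclideanSpace.proj (𝕜 := ℝ) (ι := Fin 3) i) ∘
      (fun y : E3 => Real.exp (quadForm a b c y / (2 * ν)) • topField a b c y)
      = fun y : E3 => Real.exp (quadForm a b c y / (2 * ν)) * topField a b c y i := by
    funext y; simp
  have hcomp : (fderiv ℝ (fun y : E3 => Real.exp (quadForm a b c y / (2 * ν)) • topField a b c y) x v) i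
      = fderiv ℝ (fun y : E3 => Real.exp (quadForm a b c y / (2 * ν)) * topField a b c y i) x v := by
    rw [← hfun, h]; rfl
  rw [hcomp, fderiv_fun_mul hσd hτd]
  simp only [_root_.add_apply, _root_.FunLike.coe_smul, Pi.smul_apply, smul_eq_mul, fderiv_sigma_apply ν a b c hν]
  ring

/-- Componentwise Laplacian of `B⋆`:  `(ΔB⋆)ᵢ = 2 Σₖ ∂ₖσ ∂ₖτᵢ + τᵢ Δσ` (since `Δτᵢ = 0`). -/
theorem laplacian_survivor_apply (hν : ν ≠ 0) (htr : a + b + c = 0) (x : E3) (i : Fin 3) :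
    ((Δ fun y : E3 => Real.exp (quadForm a b c y / (2 * ν)) • topField a b c y) x) i
      = 2 * ∑ k : Fin 3, (Real.exp (quadForm a b c x / (2 * ν))
            * (inner ℝ (strain a b c x) (EuclideanSpace.single k (1 : ℝ)) / ν))
            * fderiv ℝ (fun y : E3 => topField a b c y i) x (EuclideanSpace.single k (1 : ℝ))
        + topField a b c x i * (Real.exp (quadForm a b c x / (2 * ν)) * ‖strain a b c x‖ ^ 2 / ν ^ 2) := by
  have h2 : ContDiffAt ℝ 2 (fun y : E3 => Real.exp (quadForm a b c y / (2 * ν)) • topField a b c y) x :=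
    (contDiff_survivor ν a b c).contDiffAt
  have h := h2.laplacian_CLM_comp_left (l := EuclideanSpace.proj (𝕜 := ℝ) (ι := Fin 3) i)
  have hfun : (EuclideanSpace.proj (𝕜 := ℝ) (ι := Fin 3) i) ∘
      (fun y : E3 => Real.exp (quadForm a b c y / (2 * ν)) • topField a b c y)
      = fun y : E3 => Real.exp (quadForm a b c y / (2 * ν)) * topField a b c y i := by
    funext y; simp
  have hcomp : ((Δ fun y : E3 => Real.exp (quadForm a b c y / (2 * ν)) • topField a b c y) x) i
      = (Δ fun y : E3 => Real.exp (quadForm a b c y / (2 * ν)) * topField a b c y i) x := by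
    rw [← hfun, h]; rfl
  rw [hcomp, Tsai2021.laplacian_mul_eq (contDiff_sigma ν a b c) (contDiff_topField_apply a b c i) x,
    laplacian_topField_apply, laplacian_sigma ν a b c hν htr, mul_zero, zero_add]
  simp only [fderiv_sigma_apply ν a b c hν]

/-- The passive viscous equation for `B⋆`, component 0. -/
theorem survivor_pde_apply_zero (hν : 0 < ν) (htr : a + b + c = 0) (x : E3) :
    (fderiv ℝ (fun y : E3 => Real.exp (quadForm a b c y / (2 * ν)) • topField a b c y) x (strain a b c x)
        - strain a b c (Real.exp (quadForm a b c x / (2 * ν)) • topField a b c x)) 0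
      = (ν • (Δ fun y : E3 => Real.exp (quadForm a b c y / (2 * ν)) • topField a b c y) x) 0 := by
  have hν0 : ν ≠ 0 := hν.ne'
  have hc : c = -a - b := by linarith
  rw [PiLp.sub_apply, PiLp.smul_apply, fderiv_survivor_apply ν a b c hν0, laplacian_survivor_apply ν a b c hν0 htr,
    smul_eq_mul]
  rw [show (fun y : E3 => topField a b c y 0) = fun y : E3 => (b - c) * y 1 * y 2 from
    funext fun y => (topField_apply a b c y).1]
  simp only [Fin.sum_univ_three, EuclideanSpace.inner_single_right, inner_strain, norm_sq_strain,
    fderiv_monomial_apply, (topField_apply a b c x).1]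
  simp [strain, topField, hc]
  field_simp
  ring

/-- The passive viscous equation for `B⋆`, component 1. -/
theorem survivor_pde_apply_one (hν : 0 < ν) (htr : a + b + c = 0) (x : E3) :
    (fderiv ℝ (fun y : E3 => Real.exp (quadForm a b c y / (2 * ν)) • topField a b c y) x (strain a b c x)
        - strain a b c (Real.exp (quadForm a b c x / (2 * ν)) • topField a b c x)) 1
      = (ν • (Δ fun y : E3 => Real.exp (quadForm a b c y / (2 * ν)) • topField a b c y) x) 1 := by
  have hν0 : ν ≠ 0 := hν.ne'
  have hc : c = -a - b := by linarith
  rw [PiLp.sub_apply, PiLp.smul_apply, fderiv_survivor_apply ν a b c hν0, laplacian_survivor_apply ν a b c hν0 htr,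
    smul_eq_mul]
  rw [show (fun y : E3 => topField a b c y 1) = fun y : E3 => (c - a) * y 2 * y 0 from
    funext fun y => (topField_apply a b c y).2.1]
  simp only [Fin.sum_univ_three, EuclideanSpace.inner_single_right, inner_strain, norm_sq_strain,
    fderiv_monomial_apply, (topField_apply a b c x).2.1]
  simp [strain, topField, hc]
  field_simp
  ring

/-- The passive viscous equation for `B⋆`, component 2. -/
theorem survivor_pde_apply_two (hν : 0 < ν) (htr : a + b + c = 0) (x : E3) :
    (fderiv ℝ (fun y : E3 => Real.exp (quadForm a b c y / (2 * ν)) • topField a b c y) x (strain a b c x)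
        - strain a b c (Real.exp (quadForm a b c x / (2 * ν)) • topField a b c x)) 2
      = (ν • (Δ fun y : E3 => Real.exp (quadForm a b c y / (2 * ν)) • topField a b c y) x) 2 := by
  have hν0 : ν ≠ 0 := hν.ne'
  have hc : c = -a - b := by linarith
  rw [PiLp.sub_apply, PiLp.smul_apply, fderiv_survivor_apply ν a b c hν0, laplacian_survivor_apply ν a b c hν0 htr,
    smul_eq_mul]
  rw [show (fun y : E3 => topField a b c y 2) = fun y : E3 => (a - b) * y 0 * y 1 from
    funext fun y => (topField_apply a b c y).2.2]
  simp only [Fin.sum_univ_three, EuclideanSpace.inner_single_right, inner_strain, norm_sq_strain,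
    fderiv_monomial_apply, (topField_apply a b c x).2.2]
  simp [strain, topField, hc]
  field_simp
  ring

/-- **THE SURVIVOR** (`ErtelTowerSketch.lean` Prop `StrainShadowSurvivor`, closed BY NAME over the twin): for `ν > 0` and
trace-free `S = diag(a,b,c)`, `B⋆(x) = exp(xᵀSx/2ν)·(Sx × x)` solves the steady passive viscous equation
`DB⋆[Sx] − SB⋆ = νΔB⋆` on all of `ℝ³`, is divergence free and tangent to the spheres, and is non-zero as soon as two principal
strains differ — the «false-without-bounded» witness in the LINEAR STRAIN SHADOW (critic V21-P1: prescribed unbounded drift `Sx`;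
`B⋆` is not the curl of a bounded NS velocity; NOT a `Negative/` entry for ⟨1222⟩). -/
theorem strainShadowSurvivor : StrainShadowSurvivor := by
  intro ν a b c hν htr
  have hν0 : ν ≠ 0 := hν.ne'
  dsimp only
  refine ⟨?_, ?_, ?_, ?_⟩
  · -- the passive viscous equation, componentwise
    intro x
    ext i
    fin_cases i
    · exact survivor_pde_apply_zero ν a b c hν htr x
    · exact survivor_pde_apply_one ν a b c hν htr x
    · exact survivor_pde_apply_two ν a b c hν htr x
  · -- divergence free: `div(στ) = σ div τ + Dσ[τ] = 0 + (σ/ν)⟪Sx, τ⟫ = 0`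
    intro x
    have hσd : DifferentiableAt ℝ (fun y : E3 => Real.exp (quadForm a b c y / (2 * ν))) x :=
      (contDiff_sigma ν a b c (n := 1)).differentiable (by simp) x
    have hτd : DifferentiableAt ℝ (topField a b c) x := (contDiff_topField a b c (n := 1)).differentiable (by simp) x
    rw [HorizonTower.divergence_smul_apply hσd hτd, divergence_topField, mul_zero, zero_add,
      fderiv_sigma_apply ν a b c hν0, real_inner_comm (topField a b c x) (strain a b c x), topField_perp_strain]
    simp
  · -- tangent to the spheres
    intro x
    rw [real_inner_smul_left, topField_tangent, mul_zero]
  · -- non-zero as soon as two principal strains differ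
    intro hne
    have hpos : ∀ y : E3, Real.exp (quadForm a b c y / (2 * ν)) ≠ 0 := fun y => (Real.exp_pos _).ne'
    rcases hne with h | h | h
    · -- a ≠ b: third component at x = (1,1,0)
      refine ⟨EuclideanSpace.single 0 (1 : ℝ) + EuclideanSpace.single 1 (1 : ℝ), ?_⟩
      intro h0
      have h2 := congrArg (fun w : E3 => w 2) h0
      have hval : (topField a b c (EuclideanSpace.single 0 (1 : ℝ) + EuclideanSpace.single 1 (1 : ℝ))) 2 = a - b := by
        simp [topField]
      simp only [PiLp.smul_apply, smul_eq_mul, hval, PiLp.zero_apply, mul_eq_zero] at h2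
      rcases h2 with h2 | h2
      · exact hpos _ h2
      · exact h (sub_eq_zero.mp h2)
    · -- b ≠ c: first component at x = (0,1,1)
      refine ⟨EuclideanSpace.single 1 (1 : ℝ) + EuclideanSpace.single 2 (1 : ℝ), ?_⟩
      intro h0
      have h2 := congrArg (fun w : E3 => w 0) h0
      have hval : (topField a b c (EuclideanSpace.single 1 (1 : ℝ) + EuclideanSpace.single 2 (1 : ℝ))) 0 = b - c := by
        simp [topField]
      simp only [PiLp.smul_apply, smul_eq_mul, hval, PiLp.zero_apply, mul_eq_zero] at h2
      rcases h2 with h2 | h2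
      · exact hpos _ h2
      · exact h (sub_eq_zero.mp h2)
    · -- c ≠ a: second component at x = (1,0,1)
      refine ⟨EuclideanSpace.single 2 (1 : ℝ) + EuclideanSpace.single 0 (1 : ℝ), ?_⟩
      intro h0
      have h2 := congrArg (fun w : E3 => w 1) h0
      have hval : (topField a b c (EuclideanSpace.single 2 (1 : ℝ) + EuclideanSpace.single 0 (1 : ℝ))) 1 = c - a := by
        simp [topField]
      simp only [PiLp.smul_apply, smul_eq_mul, hval, PiLp.zero_apply, mul_eq_zero] at h2
      rcases h2 with h2 | h2
      · exact hpos _ h2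
      · exact h (sub_eq_zero.mp h2)

end Survivor


end Summit.NavierStokesRegularity.NavierStokesRegularity.Theorems.PoloidalLiouville.ErtelTower
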